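import Literature.Geometry.Riemannian.RicciDeTurckExistence
import Literature.Geometry.Riemannian.RicciFlowScalarCurvatureRegularity
import Literature.Geometry.Lorentzian.CurvatureRegularity
import HarnessLib

/-!
# The DeTurck vector field of a smooth family of metrics is smooth on space-time
(topic `Geometry/Riemannian`)

Fourth file of the proved existence-direction DeTurck reduction of
`Literature.Geometry.Riemannian.ricciFlow_shortTime_existence` (`RicciDeTurckExistence.lean`).
There the parabolic input (RDT-existence) carried, besides short-time existence of a smooth
Ricci–DeTurck flow `g` on `M × [0, ε]`, the clause that its DeTurck vector field
`W_t = g_t^{pq}(Γ(g_t)^k_{pq} - Γ̃^k_{pq})` (`deTurckField`, `RicciDeTurckFlow.lean`;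
Andrews–Hopper 2011, (5.7)) is `C^∞` on `M × [0, ε]`. This file PROVES that clause from the
smoothness of the family (Topping 2006, §5.2, Step 2 (i)–(ii): the vector field integrated to
the diffeomorphisms `ψ_t` "is smooth" because `g(t)` is a smooth family; in coordinates the
Christoffel symbols `Γ(g_t)^k_{ij} = ½ g_t^{kl}(∂_i (g_t)_{jl} + ∂_j (g_t)_{il} - ∂_l (g_t)_{ij})`,
Gallot–Hulin–Lafontaine 2004, Prop. 2.54, are smooth in `(x, t)` when `(g_t)_{ij}` is), and
records the slimmer reduction `ricciFlow_shortTime_existence_of_deTurck'`.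

* `contMDiffWithinAt_mvfderiv_slice_apply` — for `F` smooth on `U × S ⊆ M × ℝ` and a smooth
  vector field `C` on `U`, `(x, t) ↦ d(F(·, t))_x (C x)` is smooth on `U × S` (Mathlib's
  `ContMDiffWithinAt.mfderivWithin`, the derivative of a parametrised family, and
  `clm_apply_of_inCoordinates`).
* `IsContMDiffFamilyOn.contMDiffOn_koszulFunctional` — the Koszul functional
  `K_{g_t}(A, B, C)(x)` of a smooth family on fixed smooth fields is smooth on `U × S`.
* `IsContMDiffFamilyOn.contMDiffWithinAt_coord_cov_frame` — for Levi-Civita witnesses `cov t` of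
  `g t`, the coordinates `(x, t) ↦ e_x(∇^t_{X_v} X_w (x))` on the frame `X_v = e⁻¹ v` of the
  trivialization `e` of `TM` at `x₁` are smooth within `(chart domain) × S` at `(x₁, t₁)`: the
  parametric form of `contMDiffAt_inCoordinates_leviCivita` (`LeviCivitaProofs.lean`:
  `e_x(∇_{X_v} X_w) = G_{x,t}⁻¹ (½ K_{g_t}(X_v, X_w, X_·)(x))`, `G` the Gram operator).
* `traceVec_eq_sum` — the metric trace of a vector-valued bilinear map in a basis,
  `tr_g B = ∑ᵢⱼ (𝒢⁻¹)ⱼᵢ B(βᵢ, βⱼ)` (O'Neill 1983, Ch. 3, pp. 60–61).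
* `contMDiffOn_deTurckField` — **the DeTurck vector field of a smooth family with Levi-Civita
  witnesses, relative to a locally `C^∞` background connection, is `C^∞` on `M × S`** as a map
  into `TM`.
* `ricciFlow_shortTime_existence_of_deTurck'` — `ricciFlow_shortTime_existence` from
  (RDT-existence) WITHOUT the smoothness clause on `W` (it holds automatically for the
  background `∇^{g₀}`, `isLocallyContMDiff_leviCivita_holds`) and (flows of time-dependent
  vector fields on closed manifolds).

## References

* P. Topping, *Lectures on the Ricci flow*, LMS LNS 325 (2006), §5.2, Steps 1–2. [Topping2006]
* B. Andrews, C. Hopper, *The Ricci flow in Riemannian geometry*, LNM 2011 (2011), §5.4.1,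
  (5.7). [AndrewsHopper2011]
* S. Gallot, D. Hulin, J. Lafontaine, *Riemannian Geometry*, 3rd ed. (2004), Prop. 2.54
  (the Christoffel symbols in coordinates). [GallotHulinLafontaine2004]
* B. O'Neill, *Semi-Riemannian geometry* (1983), Ch. 3, pp. 60–61 (metric contraction).
  [ONeill1983]
* J. M. Lee, *Introduction to Smooth Manifolds*, 2nd ed. (2012), Thm. 9.48. [Lee2012]
-/

noncomputable section

open Bundle Set Filter Function
open scoped Manifold ContDiff Topology

namespace Literature.Geometry.Riemannian

open Lorentzian Lorentzian.PseudoRiemannianMetric Literature.Geometry.Manifold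

universe u v w

variable {E : Type*} [NormedAddCommGroup E] [NormedSpace ℝ E] {H : Type*} [TopologicalSpace H]
  {I : ModelWithCorners ℝ E H} {M : Type*} [TopologicalSpace M] [ChartedSpace H M]
  [IsManifold I ∞ M]

/-! ### Derivatives along fields of functions smooth on `U × S` -/

/-- **Differentiating a space-time function along a vector field keeps it smooth on space-time.**
If `F : M × ℝ → ℝ` is `C^∞` on `U × S` (`U` open) and `C` is a `C^∞` vector field on `U`, then
`(x, t) ↦ d(F(·, t))_x (C x)` (`mvfderiv` of the time slice) is `C^∞` within `U × S` at every
point of `U × S`: Mathlib's `ContMDiffWithinAt.mfderivWithin` (the differential of the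
parametrised family `(x, t), y ↦ F(y, t)` is smooth in the parameter, in tangent coordinates)
followed by `ContMDiffWithinAt.clm_apply_of_inCoordinates`; compare the purely spatial
`contMDiffAt_mvfderiv_apply_of_le` (`LeviCivitaProofs.lean`). [folklore] -/
theorem contMDiffWithinAt_mvfderiv_slice_apply {U : Set M} (hU : IsOpen U) {S : Set ℝ}
    {F : M × ℝ → ℝ} {p₀ : M × ℝ} (hp₀ : p₀ ∈ U ×ˢ S)
    (hF : ContMDiffOn (I.prod 𝓘(ℝ, ℝ)) 𝓘(ℝ, ℝ) ∞ F (U ×ˢ S))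
    {C : Π x : M, TangentSpace I x}
    (hC : ContMDiffOn I I.tangent ∞ (fun x ↦ (⟨x, C x⟩ : TangentBundle I M)) U) :
    ContMDiffWithinAt (I.prod 𝓘(ℝ, ℝ)) 𝓘(ℝ, ℝ) ∞
      (fun p : M × ℝ ↦ mvfderiv I (fun y ↦ F (y, p.2)) p.1 (C p.1)) (U ×ˢ S) p₀ := by
  -- the parametrised family `f p y = F (y, p.2)`, smooth on `(U × S) × U`
  have hf : ContMDiffWithinAt ((I.prod 𝓘(ℝ, ℝ)).prod I) 𝓘(ℝ, ℝ) ∞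
      (Function.uncurry fun (p : M × ℝ) (y : M) ↦ F (y, p.2)) ((U ×ˢ S) ×ˢ U) (p₀, p₀.1) := by
    have h1 : ContMDiffWithinAt (I.prod 𝓘(ℝ, ℝ)) 𝓘(ℝ, ℝ) ∞ F (U ×ˢ S) p₀ := hF p₀ hp₀
    have h2 : ContMDiffWithinAt ((I.prod 𝓘(ℝ, ℝ)).prod I) (I.prod 𝓘(ℝ, ℝ)) ∞
        (fun r : (M × ℝ) × M ↦ ((r.2, r.1.2) : M × ℝ)) ((U ×ˢ S) ×ˢ U) (p₀, p₀.1) :=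
      contMDiffWithinAt_snd.prodMk contMDiffWithinAt_fst.snd
    exact h1.comp_of_eq h2 (fun r hr ↦ mk_mem_prod hr.2 hr.1.2) rfl
  have key := ContMDiffWithinAt.mfderivWithin (I' := 𝓘(ℝ, ℝ)) (m := ∞) hf contMDiffWithinAt_fst
    hp₀ (fun p hp ↦ hp.1) (by exact_mod_cast le_top) hU.uniqueMDiffOn
  have hv : ContMDiffWithinAt (I.prod 𝓘(ℝ, ℝ)) I.tangent ∞
      (fun p : M × ℝ ↦ (⟨p.1, C p.1⟩ : TangentBundle I M)) (U ×ˢ S) p₀ :=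
    (hC p₀.1 hp₀.1).comp p₀ contMDiffWithinAt_fst (fun p hp ↦ hp.1)
  have hb₂ : ContMDiffWithinAt (I.prod 𝓘(ℝ, ℝ)) 𝓘(ℝ, ℝ) ∞ (fun p : M × ℝ ↦ F (p.1, p.2))
      (U ×ˢ S) p₀ := hF p₀ hp₀
  have h3 := ContMDiffWithinAt.clm_apply_of_inCoordinates (b₁ := Prod.fst)
    (b₂ := fun p : M × ℝ ↦ F (p.1, p.2)) (v := fun p : M × ℝ ↦ C p.1) key hv hb₂
  have h4 := ((contMDiff_snd_tangentBundle_modelSpace ℝ 𝓘(ℝ, ℝ) (n := ∞)).contMDiffAt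
    (x := (⟨F (p₀.1, p₀.2), mfderivWithin I 𝓘(ℝ, ℝ) (fun y ↦ F (y, p₀.2)) U p₀.1 (C p₀.1)⟩ :
      TangentBundle 𝓘(ℝ, ℝ) ℝ))).comp_contMDiffWithinAt p₀ h3
  refine h4.congr (fun p hp ↦ ?_) ?_
  · change mvfderiv I (fun y ↦ F (y, p.2)) p.1 (C p.1) =
      mfderivWithin I 𝓘(ℝ, ℝ) (fun y ↦ F (y, p.2)) U p.1 (C p.1)
    rw [mfderivWithin_of_isOpen hU hp.1]
    rfl
  · change mvfderiv I (fun y ↦ F (y, p₀.2)) p₀.1 (C p₀.1) =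
      mfderivWithin I 𝓘(ℝ, ℝ) (fun y ↦ F (y, p₀.2)) U p₀.1 (C p₀.1)
    rw [mfderivWithin_of_isOpen hU hp₀.1]
    rfl

/-! ### The Koszul functional of a smooth family on fixed smooth fields -/

section Koszul

variable [FiniteDimensional ℝ E] [CompleteSpace E]
  {g : ℝ → PseudoRiemannianMetric I ∞ E (TangentSpace I : M → Type _)} {S : Set ℝ}

omit [FiniteDimensional ℝ E] in
/-- The Lie bracket of `C^∞` vector fields on an open set is `C^∞` there (Mathlib's
`ContMDiffAt.mlieBracket_vectorField`). [folklore] -/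
theorem contMDiffOn_mlieBracket_of_isOpen {U : Set M} (hU : IsOpen U)
    {B C : Π x : M, TangentSpace I x}
    (hB : ContMDiffOn I I.tangent ∞ (fun x ↦ (⟨x, B x⟩ : TangentBundle I M)) U)
    (hC : ContMDiffOn I I.tangent ∞ (fun x ↦ (⟨x, C x⟩ : TangentBundle I M)) U) :
    ContMDiffOn I I.tangent ∞
      (fun x ↦ (⟨x, VectorField.mlieBracket I B C x⟩ : TangentBundle I M)) U := by
  haveI : IsManifold I (((⊤ : ℕ∞) : ℕ∞ω) + 1) M := IsManifold.of_le (n := ∞) (mod_cast le_top)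
  haveI : IsManifold I (minSmoothness ℝ 2) M := by
    rw [minSmoothness_of_isRCLikeNormedField]; infer_instance
  intro x hx
  have hBx : CMDiffAt ((⊤ : ℕ∞) : ℕ∞ω) (T% B) x := (hB x hx).contMDiffAt (hU.mem_nhds hx)
  have hCx : CMDiffAt ((⊤ : ℕ∞) : ℕ∞ω) (T% C) x := (hC x hx).contMDiffAt (hU.mem_nhds hx)
  have hbr : CMDiffAt ((⊤ : ℕ∞) : ℕ∞ω) (T% (VectorField.mlieBracket I B C)) x :=
    ContMDiffAt.mlieBracket_vectorField (I := I) (m := ⊤) (n := ⊤) hBx hCx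
      (by rw [minSmoothness_of_isRCLikeNormedField]; exact_mod_cast le_top)
  exact hbr.contMDiffWithinAt

omit [FiniteDimensional ℝ E] in
/-- **The Koszul functional of a smooth family of metrics on fixed smooth fields is smooth on
space-time.** For `IsContMDiffFamilyOn ∞ g S`, an open set `U` and `C^∞` vector fields `A, B, C`
on `U`, the function `(x, t) ↦ K_{g_t}(A, B, C)(x) = A g_t(B,C) + B g_t(C,A) - C g_t(A,B)
- g_t(A,[B,C]) + g_t(B,[C,A]) + g_t(C,[A,B])` is `C^∞` on `U × S`: the three derivative terms by
`contMDiffWithinAt_mvfderiv_slice_apply` (the paired functions `(x, t) ↦ g_t(P, Q)(x)` are smooth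
on `U × S`, `IsContMDiffFamilyOn.contMDiffOn_val_apply`), the three bracket terms by the same
lemma with the smooth fields `[Q, R]`. This is the regularity count behind the smoothness in
`(x, t)` of the Christoffel symbols of `g_t` (Gallot–Hulin–Lafontaine 2004, Prop. 2.54).
[cite: GallotHulinLafontaine2004, Prop. 2.54 (p. 70)] -/
theorem IsContMDiffFamilyOn.contMDiffOn_koszulFunctional (hg : IsContMDiffFamilyOn ∞ g S)
    {U : Set M} (hU : IsOpen U) {A B C : Π x : M, TangentSpace I x}
    (hA : ContMDiffOn I I.tangent ∞ (fun x ↦ (⟨x, A x⟩ : TangentBundle I M)) U)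
    (hB : ContMDiffOn I I.tangent ∞ (fun x ↦ (⟨x, B x⟩ : TangentBundle I M)) U)
    (hC : ContMDiffOn I I.tangent ∞ (fun x ↦ (⟨x, C x⟩ : TangentBundle I M)) U) :
    ContMDiffOn (I.prod 𝓘(ℝ, ℝ)) 𝓘(ℝ, ℝ) ∞
      (fun p : M × ℝ ↦ (g p.2).koszulFunctional A B C p.1) (U ×ˢ S) := by
  intro p₀ hp₀
  -- derivative terms `R g(P, Q)`
  have hd : ∀ {P Q R : Π x : M, TangentSpace I x},
      ContMDiffOn I I.tangent ∞ (fun x ↦ (⟨x, P x⟩ : TangentBundle I M)) U →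
      ContMDiffOn I I.tangent ∞ (fun x ↦ (⟨x, Q x⟩ : TangentBundle I M)) U →
      ContMDiffOn I I.tangent ∞ (fun x ↦ (⟨x, R x⟩ : TangentBundle I M)) U →
      ContMDiffWithinAt (I.prod 𝓘(ℝ, ℝ)) 𝓘(ℝ, ℝ) ∞
        (fun p : M × ℝ ↦ mvfderiv I (fun z ↦ (g p.2).val z (P z) (Q z)) p.1 (R p.1))
        (U ×ˢ S) p₀ :=
    fun hP hQ hR ↦ contMDiffWithinAt_mvfderiv_slice_apply hU hp₀
      (hg.contMDiffOn_val_apply hP hQ) hR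
  -- bracket terms `g(P, [Q, R])`
  have hb : ∀ {P Q R : Π x : M, TangentSpace I x},
      ContMDiffOn I I.tangent ∞ (fun x ↦ (⟨x, P x⟩ : TangentBundle I M)) U →
      ContMDiffOn I I.tangent ∞ (fun x ↦ (⟨x, Q x⟩ : TangentBundle I M)) U →
      ContMDiffOn I I.tangent ∞ (fun x ↦ (⟨x, R x⟩ : TangentBundle I M)) U →
      ContMDiffWithinAt (I.prod 𝓘(ℝ, ℝ)) 𝓘(ℝ, ℝ) ∞
        (fun p : M × ℝ ↦ (g p.2).val p.1 (P p.1) (VectorField.mlieBracket I Q R p.1))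
        (U ×ˢ S) p₀ :=
    fun hP hQ hR ↦ hg.contMDiffOn_val_apply hP (contMDiffOn_mlieBracket_of_isOpen hU hQ hR) p₀ hp₀
  have : (fun p : M × ℝ ↦ (g p.2).koszulFunctional A B C p.1) = fun p ↦
      mvfderiv I (fun z ↦ (g p.2).val z (B z) (C z)) p.1 (A p.1)
        + mvfderiv I (fun z ↦ (g p.2).val z (C z) (A z)) p.1 (B p.1)
        - mvfderiv I (fun z ↦ (g p.2).val z (A z) (B z)) p.1 (C p.1)
        - (g p.2).val p.1 (A p.1) (VectorField.mlieBracket I B C p.1)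
        + (g p.2).val p.1 (B p.1) (VectorField.mlieBracket I C A p.1)
        + (g p.2).val p.1 (C p.1) (VectorField.mlieBracket I A B p.1) := by
    funext p; rfl
  rw [this]
  exact ((((hd hB hC hA).add (hd hC hA hB)).sub (hd hA hB hC)).sub (hb hA hB hC)).add
    (hb hB hC hA) |>.add (hb hC hA hB)

end Koszul

/-! ### The connections of the family on the coordinate frame, in coordinates -/

section Frame

variable [FiniteDimensional ℝ E] [CompleteSpace E]
  {g : ℝ → PseudoRiemannianMetric I ∞ E (TangentSpace I : M → Type _)}
  {cov : ℝ → CovariantDerivative I E (TangentSpace I : M → Type _)} {S : Set ℝ}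

omit [FiniteDimensional ℝ E] [CompleteSpace E] in
/-- The frame field `X_v : x ↦ e_x⁻¹ v` of the trivialization `e` of `TM` at `x₁` is `C^∞` on the
chart domain of `x₁` (it has constant coordinate `v`). [folklore] -/
theorem contMDiffOn_symmL_frame (x₁ : M) (v : E) :
    ContMDiffOn I I.tangent ∞ (fun x ↦ (⟨x, (trivializationAt E (TangentSpace I : M → Type _)
      x₁).symmL ℝ x v⟩ : TangentBundle I M)) (chartAt H x₁).source := by
  have h : CMDiff[(trivializationAt E (TangentSpace I : M → Type _) x₁).baseSet] ∞
      (T% (fun x : M ↦ (trivializationAt E (TangentSpace I : M → Type _) x₁).symmL ℝ x v)) := by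
    rw [(trivializationAt E (TangentSpace I : M → Type _) x₁).contMDiffOn_section_baseSet_iff]
    apply (contMDiffOn_const (c := v)).congr
    intro y hy
    change ((trivializationAt E (TangentSpace I : M → Type _) x₁)
      ⟨y, (trivializationAt E (TangentSpace I : M → Type _) x₁).symmL ℝ y v⟩).2 = v
    rw [Trivialization.symmL_apply _ hy, Trivialization.apply_mk_symm _ hy]
  rwa [TangentBundle.trivializationAt_baseSet] at h

/-- **The Levi-Civita witnesses of a smooth family, on the coordinate frame, are smooth on
space-time in coordinates** (parametric form of `contMDiffAt_inCoordinates_leviCivita`,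
`LeviCivitaProofs.lean`; Gallot–Hulin–Lafontaine 2004, Prop. 2.54: the Christoffel symbols
`Γ(g_t)^k_{ij} = ½ g_t^{kl}(∂_i (g_t)_{jl} + ∂_j (g_t)_{il} - ∂_l (g_t)_{ij})` of the metrics
`g_t` are smooth in `(x, t)` when the coefficients `(g_t)_{ij}(x)` are). Let `g` be `C^∞` on
`M × S`, `cov t` a Levi-Civita connection of `g t` for `t ∈ S`, `e` the trivialization of `TM` at
`x₁` with frame `X_v : x ↦ e_x⁻¹ v`, and `t₁ ∈ S`. Then for `v, w ∈ E` the coordinate function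
`(x, t) ↦ e_x(∇^t_{X_v} X_w (x))` is `C^∞` within `(chart domain of x₁) × S` at `(x₁, t₁)`.
Proof: `G_{x,t}(e_x ∇^t_{X_v} X_w) = ½ K_{g_t}(X_v, X_w, X_·)(x)` by the Koszul identity for
the torsion-free compatible `cov t` (`IsLeviCivita.two_mul_val_apply_eq_koszulFunctional`), with
`G_{x,t}(a)(b) = g_t(X_a, X_b)(x)` the Gram operator — smooth in `(x, t)`
(`IsContMDiffFamilyOn.contMDiffOn_bilinInChart`) and invertible
(`isInvertible_bilinearComp_symmL`) — and the right-hand side is smooth in `(x, t)`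
(`IsContMDiffFamilyOn.contMDiffOn_koszulFunctional`). [cite: GallotHulinLafontaine2004, Prop. 2.54 (p. 70)] -/
theorem IsContMDiffFamilyOn.contMDiffWithinAt_coord_cov_frame (hg : IsContMDiffFamilyOn ∞ g S)
    (hLC : ∀ t ∈ S, (g t).IsLeviCivita (cov t)) (x₁ : M) {t₁ : ℝ} (ht₁ : t₁ ∈ S) (v w : E) :
    ContMDiffWithinAt (I.prod 𝓘(ℝ, ℝ)) 𝓘(ℝ, E) ∞
      (fun p : M × ℝ ↦ (trivializationAt E (TangentSpace I : M → Type _) x₁).continuousLinearMapAt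
        ℝ p.1 ((cov p.2) (fun x : M ↦ (trivializationAt E (TangentSpace I : M → Type _)
          x₁).symmL ℝ x w) p.1 ((trivializationAt E (TangentSpace I : M → Type _) x₁).symmL ℝ
            p.1 v)))
      ((chartAt H x₁).source ×ˢ S) (x₁, t₁) := by
  set e := trivializationAt E (TangentSpace I : M → Type _) x₁ with he
  set U : Set M := (chartAt H x₁).source with hU_def
  have hU : IsOpen U := (chartAt H x₁).open_source
  have hUe : ∀ x ∈ U, x ∈ e.baseSet := fun x hx ↦ by
    rwa [he, TangentBundle.trivializationAt_baseSet]
  set A : Set (M × ℝ) := U ×ˢ S with hA_def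
  have hp₀ : ((x₁, t₁) : M × ℝ) ∈ A := mk_mem_prod (mem_chart_source H x₁) ht₁
  -- the frame
  set X : E → Π x : M, TangentSpace I x := fun a x ↦ e.symmL ℝ x a with hX_def
  have hX : ∀ a, ContMDiffOn I I.tangent ∞ (fun x ↦ (⟨x, X a x⟩ : TangentBundle I M)) U :=
    fun a ↦ contMDiffOn_symmL_frame x₁ a
  have hXd : ∀ a, ∀ x ∈ U, MDiffAt (T% (X a)) x := fun a x hx ↦
    ((hX a x hx).contMDiffAt (hU.mem_nhds hx)).mdifferentiableAt (by simp)
  -- the Koszul identity for the witnesses `cov t`, `t ∈ S`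
  have koszul : ∀ p ∈ A, ∀ a b c : E,
      2 * (g p.2).val p.1 ((cov p.2) (X b) p.1 (X a p.1)) (X c p.1) =
        (g p.2).koszulFunctional (X a) (X b) (X c) p.1 :=
    fun p hp a b c ↦ (hLC p.2 hp.2).two_mul_val_apply_eq_koszulFunctional (hXd a _ hp.1)
      (hXd b _ hp.1) (hXd c _ hp.1)
  -- the Gram operator family
  set G : M × ℝ → E →L[ℝ] E →L[ℝ] ℝ := fun p ↦ bilinInChart (g p.2) x₁ p.1 with hG_def
  have hGapply : ∀ p a b, G p a b = (g p.2).val p.1 (X a p.1) (X b p.1) := fun _ _ _ ↦ rfl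
  have hG : ContMDiffWithinAt (I.prod 𝓘(ℝ, ℝ)) 𝓘(ℝ, E →L[ℝ] E →L[ℝ] ℝ) ∞ G A (x₁, t₁) :=
    hg.contMDiffOn_bilinInChart x₁ (x₁, t₁) hp₀
  have hGinv : ∀ p ∈ A, (G p).IsInvertible := by
    intro p hp
    have h := (g p.2).isInvertible_bilinearComp_symmL (hUe p.1 hp.1)
    have hGeq : G p = ContinuousLinearMap.bilinearComp
        (show E →L[ℝ] E →L[ℝ] ℝ from (g p.2).val p.1) (show E →L[ℝ] E from e.symmL ℝ p.1)
        (show E →L[ℝ] E from e.symmL ℝ p.1) := by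
      ext a b
      rfl
    rwa [hGeq]
  have hGi : ContMDiffWithinAt (I.prod 𝓘(ℝ, ℝ)) 𝓘(ℝ, (E →L[ℝ] ℝ) →L[ℝ] E) ∞
      (fun p ↦ (G p).inverse) A (x₁, t₁) :=
    (hGinv _ hp₀).contDiffAt_map_inverse.comp_contMDiffWithinAt hG
  -- the coordinate function `c` and `φ = G c`
  set c : M × ℝ → E := fun p ↦ e.continuousLinearMapAt ℝ p.1 ((cov p.2) (X w) p.1 (X v p.1))
    with hc_def
  set φ : M × ℝ → E →L[ℝ] ℝ := fun p ↦ G p (c p) with hφ_def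
  have hφapply : ∀ p ∈ A, ∀ z : E,
      φ p z = (1 / 2 : ℝ) * (g p.2).koszulFunctional (X v) (X w) (X z) p.1 := by
    intro p hp z
    have h1 : φ p z = (g p.2).val p.1 (X (c p) p.1) (X z p.1) := hGapply p (c p) z
    have h2 : X (c p) p.1 = (cov p.2) (X w) p.1 (X v p.1) :=
      e.symmL_continuousLinearMapAt (hUe p.1 hp.1) _
    rw [h1, h2, ← koszul p hp v w z]
    ring
  have hφ : ContMDiffWithinAt (I.prod 𝓘(ℝ, ℝ)) 𝓘(ℝ, E →L[ℝ] ℝ) ∞ φ A (x₁, t₁) := by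
    rw [contMDiffWithinAt_clm_apply_iff]
    intro z
    have hK := hg.contMDiffOn_koszulFunctional hU (hX v) (hX w) (hX z) (x₁, t₁) hp₀
    exact ((contMDiffWithinAt_const (c := (1 / 2 : ℝ))).mul hK).congr
      (fun p hp ↦ hφapply p hp z) (hφapply _ hp₀ z)
  -- `c = G⁻¹ φ` on `A`
  have hc : ∀ p ∈ A, c p = (G p).inverse (φ p) := fun p hp ↦
    ((hGinv p hp).inverse_apply_self (c p)).symm
  exact (hGi.clm_apply hφ).congr (fun p hp ↦ hc p hp) (hc _ hp₀)

end Frame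

/-! ### The metric trace of a vector-valued bilinear map in a basis -/

section TraceVec

variable [FiniteDimensional ℝ E]

/-- **The metric trace of a vector-valued bilinear map in a basis**:
`tr_g B = ∑ᵢⱼ (𝒢⁻¹)ⱼᵢ B(βᵢ, βⱼ)` with `𝒢` the Gram matrix of the basis `β` of `T_x M` (O'Neill
1983, Ch. 3, pp. 60–61, metric contraction; from `val_traceVec`, `trace_eq_sum_gram_inv` and
nondegeneracy). [cite: ONeill1983, Ch. 3, pp. 60–61] -/
theorem traceVec_eq_sum {n : ℕ∞ω} (g : PseudoRiemannianMetric I n E (TangentSpace I : M → Type _))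
    (x : M) {ι : Type*} [Fintype ι] [DecidableEq ι] (β : Module.Basis ι ℝ (TangentSpace I x))
    (B : TangentSpace I x →L[ℝ] TangentSpace I x →L[ℝ] TangentSpace I x) :
    traceVec g x B = ∑ i, ∑ j, (Matrix.of fun i j ↦ g.val x (β i) (β j))⁻¹ j i • B (β i) (β j) := by
  refine sub_eq_zero.1 (g.nondegenerate x _ fun Z ↦ ?_)
  rw [map_sub, _root_.sub_apply, val_traceVec, trace_eq_sum_gram_inv g x β]
  simp only [bilinFormOfVec_apply, map_sum, map_smul, _root_.sum_apply, _root_.smul_apply,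
    smul_eq_mul, sub_self]

end TraceVec

/-! ### The DeTurck vector field of a smooth family is smooth on `M × S` -/

section DeTurck

variable [FiniteDimensional ℝ E] [CompleteSpace E]
  {g : ℝ → PseudoRiemannianMetric I ∞ E (TangentSpace I : M → Type _)}
  {cov : ℝ → CovariantDerivative I E (TangentSpace I : M → Type _)}
  {bg : CovariantDerivative I E (TangentSpace I : M → Type _)} {S : Set ℝ}

set_option maxSynthPendingDepth 2 in
-- nested operator spaces over the tangent fibres
/-- **The DeTurck vector field of a smooth family of metrics is smooth on space-time.** Let the
family `g` be `C^∞` on `M × S` (`IsContMDiffFamilyOn ∞ g S`), `cov t` a Levi-Civita connection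
of `g t` for every `t ∈ S`, and `bg = ∇̃` a locally `C^∞` covariant derivative on `TM` (e.g. the
Levi-Civita connection of a smooth background metric, `isLocallyContMDiff_leviCivita_holds`).
Then the DeTurck vector field `(x, t) ↦ W_t(x) = g_t^{pq}(Γ(g_t)^k_{pq} - Γ̃^k_{pq})(x)`
(`deTurckField (g t) (cov t) bg x`; Andrews–Hopper 2011, (5.7)) is `C^∞` on `M × S` as a map
into `TM`. Proof, in the trivialization `e` of `TM` at `x₁` with frame `X_a = e⁻¹ a` and a basis
`b` of `E`: `e_x(W_t(x)) = ∑ᵢⱼ (𝒢_{x,t}⁻¹)ⱼᵢ (e_x(∇^t_{X_{bⱼ}} X_{bᵢ}) - e_x(∇̃_{X_{bⱼ}} X_{bᵢ}))`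
(`traceVec_eq_sum`, Mathlib's `difference_apply`), with the Gram matrix `𝒢` of the frame smooth
in `(x, t)` and invertible (`contMDiffWithinAt_matrix_inv`, `det_gram_ne_zero`), the first
coordinates smooth in `(x, t)` (`contMDiffWithinAt_coord_cov_frame`) and the second smooth in
`x` (`bg` locally `C^∞` on the smooth frame). This is the smoothness of the time-dependent field
integrated in Topping 2006, §5.2, Step 2 (ii). [cite: AndrewsHopper2011, §5.4.1, (5.7)]
[cite: Topping2006, §5.2, Step 2] -/
theorem contMDiffOn_deTurckField (hg : IsContMDiffFamilyOn ∞ g S)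
    (hLC : ∀ t ∈ S, (g t).IsLeviCivita (cov t)) (hbg : bg.IsLocallyContMDiff ∞) :
    ContMDiffOn (I.prod 𝓘(ℝ, ℝ)) I.tangent ∞
      (fun q : M × ℝ ↦ (⟨q.1, deTurckField (g q.2) (cov q.2) bg q.1⟩ : TangentBundle I M))
      (univ ×ˢ S) := by
  classical
  rintro ⟨x₁, t₁⟩ ⟨-, ht₁⟩
  set e := trivializationAt E (TangentSpace I : M → Type _) x₁ with he
  set U : Set M := (chartAt H x₁).source with hU_def
  have hU : IsOpen U := (chartAt H x₁).open_source
  have hUe : ∀ x ∈ U, x ∈ e.baseSet := fun x hx ↦ by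
    rwa [he, TangentBundle.trivializationAt_baseSet]
  set A : Set (M × ℝ) := U ×ˢ S with hA_def
  have hp₀ : ((x₁, t₁) : M × ℝ) ∈ A := mk_mem_prod (mem_chart_source H x₁) ht₁
  have hA_nhds : A ∈ 𝓝[univ ×ˢ S] ((x₁, t₁) : M × ℝ) := by
    have h : U ×ˢ (univ : Set ℝ) ∈ 𝓝 ((x₁, t₁) : M × ℝ) :=
      prod_mem_nhds (hU.mem_nhds (mem_chart_source H x₁)) univ_mem
    refine mem_nhdsWithin_iff_exists_mem_nhds_inter.2 ⟨_, h, ?_⟩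
    rintro ⟨x, t⟩ ⟨⟨hx, -⟩, -, ht⟩
    exact mk_mem_prod hx ht
  -- the frame and the basis
  set X : E → Π x : M, TangentSpace I x := fun a x ↦ e.symmL ℝ x a with hX_def
  have hX : ∀ a, ContMDiffOn I I.tangent ∞ (fun x ↦ (⟨x, X a x⟩ : TangentBundle I M)) U :=
    fun a ↦ contMDiffOn_symmL_frame x₁ a
  have hXd : ∀ a, ∀ x ∈ U, MDiffAt (T% (X a)) x := fun a x hx ↦
    ((hX a x hx).contMDiffAt (hU.mem_nhds hx)).mdifferentiableAt (by simp)
  set b := Module.finBasis ℝ E with hb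
  -- the pieces, as functions of `p = (x, t)`
  set Gram : M × ℝ → Matrix (Fin (Module.finrank ℝ E)) (Fin (Module.finrank ℝ E)) ℝ :=
    fun p ↦ Matrix.of fun i j ↦ (g p.2).val p.1 (X (b i) p.1) (X (b j) p.1) with hGram_def
  set c : E → E → M × ℝ → E := fun v w p ↦
    e.continuousLinearMapAt ℝ p.1 ((cov p.2) (X w) p.1 (X v p.1)) with hc_def
  set d : E → E → M → E := fun v w x ↦ e.continuousLinearMapAt ℝ x (bg (X w) x (X v x))
    with hd_def
  set Wc : M × ℝ → E := fun p ↦ ∑ i, ∑ j, (Gram p)⁻¹ j i • (c (b j) (b i) p - d (b j) (b i) p.1)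
    with hWc_def
  /- ─── (1) the coordinate formula for `W` on `A` ─── -/
  have hformula : ∀ p ∈ A,
      e.continuousLinearMapAt ℝ p.1 (deTurckField (g p.2) (cov p.2) bg p.1) = Wc p := by
    rintro ⟨x, t⟩ ⟨hx, ht⟩
    have hxe : x ∈ e.baseSet := hUe x hx
    -- the basis `β i = X (b i) x` of `T_x M`
    set β : Module.Basis (Fin (Module.finrank ℝ E)) ℝ (TangentSpace I x) :=
      b.map (e.continuousLinearEquivAt ℝ x hxe).symm.toLinearEquiv with hβ_def
    have hβ : ∀ i, β i = X (b i) x := by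
      intro i
      simp only [hβ_def, Module.Basis.map_apply, ContinuousLinearEquiv.coe_toLinearEquiv,
        hX_def]
      rw [Trivialization.continuousLinearEquivAt_symm_apply, e.symmL_apply hxe]
    -- `tr_g B = ∑ (𝒢⁻¹)ⱼᵢ B(βᵢ, βⱼ)`
    have htr := traceVec_eq_sum (g t) x β ((cov t).difference bg x)
    -- the difference tensor on the frame
    have hdiff : ∀ i j, (cov t).difference bg x (β i) (β j) =
        (cov t) (X (b i)) x (X (b j) x) - bg (X (b i)) x (X (b j) x) := by
      intro i j
      rw [hβ i, hβ j]
      have h := IsCovariantDerivativeOn.difference_apply (x := x) (cov t).isCovariantDerivativeOnUniv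
        bg.isCovariantDerivativeOnUniv (σ := X (b i)) (by trivial) (hXd (b i) x hx)
      change ((cov t).isCovariantDerivativeOnUniv.difference bg.isCovariantDerivativeOnUniv x)
        (X (b i) x) (X (b j) x) = _
      rw [h]
      rfl
    have hgram : (Matrix.of fun i j ↦ (g t).val x (β i) (β j)) = Gram (x, t) := by
      ext i j
      simp only [Matrix.of_apply, hβ, hGram_def]
    change e.continuousLinearMapAt ℝ x (deTurckField (g t) (cov t) bg x) = Wc (x, t)
    rw [deTurckField, htr, hgram]
    simp only [hWc_def, map_sum, map_smul, hdiff, map_sub, hc_def, hd_def]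
  /- ─── (2) smoothness of the pieces within `A` at `(x₁, t₁)` ─── -/
  -- Gram matrix entries and the inverse matrix
  have hGram : ∀ i j, ContMDiffWithinAt (I.prod 𝓘(ℝ, ℝ)) 𝓘(ℝ, ℝ) ∞ (fun p ↦ Gram p i j) A
      (x₁, t₁) := fun i j ↦
    hg.contMDiffOn_val_apply (hX (b i)) (hX (b j)) (x₁, t₁) hp₀
  have hdet : (Gram (x₁, t₁)).det ≠ 0 := by
    have hxe : x₁ ∈ e.baseSet := hUe x₁ (mem_chart_source H x₁)
    set β : Module.Basis (Fin (Module.finrank ℝ E)) ℝ (TangentSpace I x₁) :=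
      b.map (e.continuousLinearEquivAt ℝ x₁ hxe).symm.toLinearEquiv with hβ_def
    have hβ : ∀ i, β i = X (b i) x₁ := by
      intro i
      simp only [hβ_def, Module.Basis.map_apply, ContinuousLinearEquiv.coe_toLinearEquiv,
        hX_def]
      rw [Trivialization.continuousLinearEquivAt_symm_apply, e.symmL_apply hxe]
    have h := det_gram_ne_zero (g t₁) x₁ β
    have hgram : (Matrix.of fun i j ↦ (g t₁).val x₁ (β i) (β j)) = Gram (x₁, t₁) := by
      ext i j
      simp only [Matrix.of_apply, hβ, hGram_def]
    rwa [hgram] at h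
  have hGinv : ∀ i j, ContMDiffWithinAt (I.prod 𝓘(ℝ, ℝ)) 𝓘(ℝ, ℝ) ∞ (fun p ↦ (Gram p)⁻¹ i j) A
      (x₁, t₁) := fun i j ↦ contMDiffWithinAt_matrix_inv hGram hdet i j
  -- the coordinates of `∇^t` on the frame
  have hc : ∀ v w, ContMDiffWithinAt (I.prod 𝓘(ℝ, ℝ)) 𝓘(ℝ, E) ∞ (c v w) A (x₁, t₁) :=
    fun v w ↦ hg.contMDiffWithinAt_coord_cov_frame hLC x₁ ht₁ v w
  -- the coordinates of `∇̃` on the frame (time-independent)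
  have hd : ∀ v w, ContMDiffOn I 𝓘(ℝ, E) ∞ (d v w) U := by
    intro v w
    have hbgU : ContMDiffCovariantDerivativeOn E ∞ bg.toFun U := hbg U hU
    have hsec : CMDiff[U] (∞ + 1) (T% (X w)) := (hX w).of_le (by exact_mod_cast le_top)
    have h1 : ContMDiffOn I (I.prod 𝓘(ℝ, E →L[ℝ] E)) ∞
        (fun x ↦ TotalSpace.mk' (E →L[ℝ] E) (E := fun x : M ↦ TangentSpace I x →L[ℝ]
          TangentSpace I x) x (bg (X w) x)) U := hbgU.contMDiff hsec
    have h2 : ContMDiffOn I I.tangent ∞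
        (fun x ↦ (⟨x, bg (X w) x (X v x)⟩ : TangentBundle I M)) U :=
      fun x hx ↦ (h1 x hx).clm_bundle_apply (hX v x hx)
    have hmaps : MapsTo (fun x ↦ (⟨x, bg (X w) x (X v x)⟩ : TangentBundle I M)) U e.source :=
      fun x hx ↦ by rw [e.mem_source]; exact hUe x hx
    have h3 := ((e.contMDiffOn_iff hmaps).1 h2).2
    refine h3.congr fun x hx ↦ ?_
    exact e.continuousLinearMapAt_apply_of_mem (R := ℝ) (hUe x hx) _
  have hd' : ∀ v w, ContMDiffWithinAt (I.prod 𝓘(ℝ, ℝ)) 𝓘(ℝ, E) ∞ (fun p : M × ℝ ↦ d v w p.1) A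
      (x₁, t₁) := fun v w ↦
    (hd v w x₁ (mem_chart_source H x₁)).comp (x₁, t₁) contMDiffWithinAt_fst (fun p hp ↦ hp.1)
  -- the coordinate function of `W`
  have hWc : ContMDiffWithinAt (I.prod 𝓘(ℝ, ℝ)) 𝓘(ℝ, E) ∞ Wc A (x₁, t₁) := by
    refine ContMDiffWithinAt.sum fun i _ ↦ ContMDiffWithinAt.sum fun j _ ↦ ?_
    exact (hGinv j i).smul ((hc (b j) (b i)).sub (hd' (b j) (b i)))
  /- ─── (3) conclusion ─── -/
  refine ContMDiffWithinAt.mono_of_mem_nhdsWithin ?_ hA_nhds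
  rw [contMDiffWithinAt_totalSpace]
  refine ⟨contMDiffWithinAt_fst, ?_⟩
  refine hWc.congr (fun p hp ↦ ?_) ?_
  · rw [← hformula p hp]
    exact (e.continuousLinearMapAt_apply_of_mem (R := ℝ) (hUe p.1 hp.1) _).symm
  · rw [← hformula _ hp₀]
    exact (e.continuousLinearMapAt_apply_of_mem (R := ℝ) (hUe x₁ (mem_chart_source H x₁)) _).symm

end DeTurck

/-! ### The slimmer reduction -/

section Reduction

/-- **The DeTurck reduction of `ricciFlow_shortTime_existence`, parabolic input without the
smoothness clause on `W`** (Topping 2006, §5.2, Steps 1–2 and Thm. 5.2.1; DeTurck 1983). ASSUME,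
on every closed manifold: (RDT-existence) `hRE` — for every `C^∞` Riemannian `g₀` and every
Levi-Civita connection `bg` of `g₀` there are `ε > 0` and a Ricci–DeTurck flow `(g, cov)`
relative to `bg` on `[0, ε]`, smooth on `M × [0, ε]`, with `g 0 = g₀` (Topping §5.2, Step 1,
(5.2.2): the parabolic input) — and (flows) `hFL` as in `ricciFlow_shortTime_existence_of_deTurck`
(Lee 2012, Thm. 9.48). THEN `ricciFlow_shortTime_existence` holds: the DeTurck vector field of
the flow relative to `∇^{g₀}` is smooth on `M × [0, ε]` by `contMDiffOn_deTurckField`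
(`∇^{g₀}` is locally `C^∞`, `isLocallyContMDiff_leviCivita_holds`), so
`ricciFlow_shortTime_existence_of_deTurck` applies. [cite: Topping2006, §5.2, Steps 1–2 and Thm. 5.2.1]
[cite: DeTurck1983] -/
theorem ricciFlow_shortTime_existence_of_deTurck'
    (hRE : ∀ {E : Type u} [NormedAddCommGroup E] [NormedSpace ℝ E] [FiniteDimensional ℝ E]
      [CompleteSpace E] {H : Type v} [TopologicalSpace H] (I : ModelWithCorners ℝ E H)
      [I.Boundaryless] (M : Type w) [TopologicalSpace M] [T2Space M] [SecondCountableTopology M]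
      [CompactSpace M] [ChartedSpace H M] [IsManifold I ∞ M]
      (g₀ : PseudoRiemannianMetric I ∞ E (TangentSpace I : M → Type _)), g₀.IsRiemannian →
      ∀ (bg : CovariantDerivative I E (TangentSpace I : M → Type _)), g₀.IsLeviCivita bg →
      ∃ ε : ℝ, 0 < ε ∧
        ∃ (g : ℝ → PseudoRiemannianMetric I ∞ E (TangentSpace I : M → Type _))
          (cov : ℝ → CovariantDerivative I E (TangentSpace I : M → Type _)),
          IsRicciDeTurckFlow g cov bg (Icc 0 ε) ∧ g 0 = g₀)
    (hFL : ∀ {E : Type u} [NormedAddCommGroup E] [NormedSpace ℝ E] [FiniteDimensional ℝ E]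
      [CompleteSpace E] {H : Type v} [TopologicalSpace H] (I : ModelWithCorners ℝ E H)
      [I.Boundaryless] (M : Type w) [TopologicalSpace M] [T2Space M] [SecondCountableTopology M]
      [CompactSpace M] [ChartedSpace H M] [IsManifold I ∞ M] (ε : ℝ), 0 < ε →
      ∀ (V : ℝ → Π x : M, TangentSpace I x),
        ContMDiffOn (I.prod 𝓘(ℝ, ℝ)) I.tangent ∞
          (fun q : M × ℝ ↦ (⟨q.1, V q.2 q.1⟩ : TangentBundle I M)) (univ ×ˢ Icc 0 ε) →
        ∃ ψ : ℝ → M → M, ψ 0 = id ∧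
          ContMDiffOn (I.prod 𝓘(ℝ, ℝ)) I ∞ (fun q : M × ℝ ↦ ψ q.2 q.1) (univ ×ˢ Icc 0 ε) ∧
          (∀ x : M, IsTimeDepMIntegralCurveOn (fun t ↦ ψ t x) V (Icc 0 ε)) ∧
          (∀ t ∈ Icc 0 ε, ∀ x : M, Injective (mfderiv I I (ψ t) x))) :
    ricciFlow_shortTime_existence.{u, v, w} := by
  refine ricciFlow_shortTime_existence_of_deTurck ?_ hFL
  intro E _ _ _ _ H _ I _ M _ _ _ _ _ _ g₀ hg₀ bg hbg
  -- only the Levi-Civita connection `∇^{g₀}` is ever used as background by the reduction, but the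
  -- hypothesis format quantifies over all Levi-Civita connections `bg` of `g₀`: these are locally
  -- `C^∞` as well (`IsLeviCivita.isLocallyContMDiff`)
  obtain ⟨ε, hε, g, cov, hRDT, hg0⟩ := hRE I M g₀ hg₀ bg hbg
  refine ⟨ε, hε, g, cov, hRDT, hg0, ?_⟩
  have hbg' : bg.IsLocallyContMDiff ∞ := by
    have h := hbg.isLocallyContMDiff (⊤ : ℕ∞) (by exact_mod_cast le_top)
    exact_mod_cast h
  exact contMDiffOn_deTurckField hRDT.smooth hRDT.isLeviCivita hbg'

end Reduction

end Literature.Geometry.Riemannian
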